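import Mathlib.NumberTheory.LegendreSymbol.Basic
import Mathlib.Tactic.FieldSimp
import Mathlib.Tactic.Push
import Literature.NumberTheory.EllipticCurves.KramerTwoDescentValuation
import HarnessLib

/-!
# Kramer's `2`-descent on `A : y² + xy = x³ + 8m x² + m(16m+1) x` — the square conditions

Continuation of `KramerTwoDescentValuation.lean` (K. Kramer, Proc. AMS 89 (1983),
[Kramer1983], §4 Lemma 2 and §5). The Theorem of §5 confines the `2`-Selmer classes of `A`
(11) by the local conditions of Lemma 2 and then imposes (p. 383–384)
`(a_p)`: second coordinate `∈ ℚ_p²` for `p ∈ 𝔏` (primes of `ℓ = 16m+1`, all `≡ 1 (4)`,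
Lemma 2 (iv): `T_p = {(a, 1, a)}`) and `(b_q)`: third coordinate `∈ ℚ_q²` for `q ∈ 𝔐`
(primes of `m`, Lemma 2 (iii): `T_q = {(a, a, 1)}`), which become linear equations in
Legendre symbols.

This file proves, for RATIONAL points and by elementary means (no Tate curve, no Hensel):

* `PadicSqLike p a` — "`a` is a `p`-adic square to first order": `a = s²` or
  `v_p(a - s²) > v_p(a)` for some rational `s` (for `a ≠ 0`, `p` odd, equivalent to
  `a ∈ ℚ_p*²` by Hensel's lemma, which is never needed: only this first-order form is
  produced and consumed); `PadicSqLike.even_padicValRat`;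
* `padicSqLike_x_add_four_mul` — Lemma 2 (iv), containment: at `p ∣ ℓ`, `p ≡ 1 (4)`,
  `x + 4m` is `p`-adically square-like for every rational point (`x + 4m - (Y/x)² =
  -(x+4m) ℓ/(4x)` if `v_p(x) < v_p(ℓ)`, else `x + 4m ≡ (i/2)²`, `i² ≡ -1`);
* `padicSqLike_x_add_l_div_four` — Lemma 2 (iii), containment: at odd `q ∣ m`, `x + ℓ/4`
  is `q`-adically square-like;
* `descentTriple_pos` — Lemma 2 (v): `x + ℓ/4 > 0`, `x (x + 4m) ≥ 0`;
* `padicSqLike_neg_m`, `padicSqLike_l` — the same for the constant values `-m`, `ℓ` of the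
  descent map at `2`-torsion points;
* `legendreSym_eq_one_of_padicSqLike` — if `M r²` (`p ∤ M`) is square-like then
  `(M/p) = 1`: the passage from `(a_p)`, `(b_q)` to Legendre symbols (p. 384).

## References

* K. Kramer, Proc. Amer. Math. Soc. 89 (1983) 379–386: §4 Lemma 2 (iii)–(v) and Remark,
  §5 proof of the Theorem, pp. 383–384 (conditions `(a_p)`, `(b_q)`). [Kramer1983]
  (held, read in full).
-/

namespace Literature.NumberTheory.EllipticCurves.KramerTwoDescent

open padicValRat

section SqLike

variable {p : ℕ} [Fact p.Prime]

/-- **"`a` is a `p`-adic square", to first order.** `PadicSqLike p a` says that some rational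
`s` has `a = s²` exactly or `v_p(a - s²) > v_p(a)`. For `a ≠ 0` and `p` odd this is
equivalent to `a ∈ (ℚ_p^×)²` (Hensel), which is how Kramer's local conditions
`(a_p)`, `(b_q)` ("`∈ ℚ_p²`") are phrased; only this first-order form is produced and consumed
in the present elementary treatment. [cite: Kramer1983, §5 (conditions (a_p), (b_q))] -/
def PadicSqLike (p : ℕ) (a : ℚ) : Prop :=
  ∃ s : ℚ, a - s ^ 2 = 0 ∨ padicValRat p a < padicValRat p (a - s ^ 2)

omit [Fact p.Prime] in
/-- An exact square is `p`-adically square-like. [folklore] -/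
theorem padicSqLike_sq (s : ℚ) : PadicSqLike p (s ^ 2) := ⟨s, Or.inl (sub_self _)⟩

/-- A square-like non-zero rational has even valuation. [folklore] -/
theorem PadicSqLike.even_padicValRat {a : ℚ} (h : PadicSqLike p a) (ha : a ≠ 0) :
    Even (padicValRat p a) := by
  obtain ⟨s, hs⟩ := h
  by_cases h0 : a - s ^ 2 = 0
  · have : a = s ^ 2 := by linear_combination h0
    rw [this, padicValRat.pow]
    exact ⟨padicValRat p s, by ring⟩
  have hs : padicValRat p a < padicValRat p (a - s ^ 2) := hs.resolve_left h0
  have hs0 : s ≠ 0 := by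
    rintro rfl
    simp at hs
  -- `a = s² + (a - s²)` with `v(s²) < v(a - s²)` forced
  by_cases hlt : padicValRat p (s ^ 2) < padicValRat p (a - s ^ 2)
  · have := (padicValRat_add_eq_left (p := p) (pow_ne_zero 2 hs0) (Or.inr hlt)).2
    rw [show s ^ 2 + (a - s ^ 2) = a by ring] at this
    rw [this, padicValRat.pow]
    exact ⟨padicValRat p s, by ring⟩
  · exfalso
    have hge : padicValRat p (a - s ^ 2) ≤ padicValRat p (s ^ 2 + (a - s ^ 2)) :=
      (le_padicValRat_add_or (p := p) (Or.inr (by omega)) (Or.inr le_rfl)).resolve_left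
        (by rw [show s ^ 2 + (a - s ^ 2) = a by ring]; exact ha)
    rw [show s ^ 2 + (a - s ^ 2) = a by ring] at hge
    omega

/-- A prime dividing `16m + 1` is odd and prime to `m` and to `4`: the valuations of `4` and
`m` vanish. [folklore] -/
theorem padicValRat_four_eq_zero_of_dvd {m : ℤ} (hpl : (p : ℤ) ∣ 16 * m + 1) :
    padicValRat p (4 : ℚ) = 0 ∧ padicValRat p (m : ℚ) = 0 := by
  have hp2 : ¬ (p : ℤ) ∣ 2 := by
    intro h2
    have : (p : ℤ) ∣ 1 := by
      have := dvd_sub hpl (dvd_mul_of_dvd_right h2 (8 * m))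
      rwa [show 16 * m + 1 - 8 * m * 2 = 1 by ring] at this
    exact (Fact.out : p.Prime).ne_one (by exact_mod_cast Int.eq_one_of_dvd_one (by positivity) this)
  have hp4 : ¬ (p : ℤ) ∣ 4 := fun h4 =>
    hp2 (((Nat.prime_iff_prime_int.mp Fact.out).dvd_or_dvd (show (p : ℤ) ∣ 2 * 2 by
      norm_num; exact h4)).elim id id)
  have hpm : ¬ (p : ℤ) ∣ m := by
    intro hm
    have : (p : ℤ) ∣ 1 := by
      have := dvd_sub hpl (dvd_mul_of_dvd_right hm 16)
      rwa [show 16 * m + 1 - 16 * m = 1 by ring] at this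
    exact (Fact.out : p.Prime).ne_one (by exact_mod_cast Int.eq_one_of_dvd_one (by positivity) this)
  refine ⟨?_, padicValRat_intCast_eq_zero hpm⟩
  have h4 := padicValRat_intCast_eq_zero (p := p) hp4
  rwa [show ((4 : ℤ) : ℚ) = 4 by norm_num] at h4

/-- **Kramer's Lemma 2 (iv), containment half** (`p ∣ b₂ - 16m = 16m + 1`, `b₂ ∈ ℚ_p²`, i.e.
`p ≡ 1 (mod 4)`): the second descent coordinate `x + 4m = x - e₂` of every rational point of
`A` is a `p`-adic square (to first order) — `T_p = {(a, 1, a)}`. Elementary proof replacing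
the Tate-curve argument of Brumer–Kramer Prop. 4.1: if `v_p(x) < v_p(16m+1)` then
`x + 4m - (Y/x)² = -(x + 4m)(16m+1)/(4x)` with `Y = y + x/2`; otherwise
`x + 4m ≡ -1/4 ≡ (i/2)²` with `i² ≡ -1 (mod p)`. This yields the necessity of Kramer's
condition `(a_p)`. [cite: Kramer1983, Lemma 2 (iv) and §5 (a_p)] -/
theorem padicSqLike_x_add_four_mul {m : ℤ} (hpl : (p : ℤ) ∣ 16 * m + 1) (hp4 : p % 4 = 1)
    {x y : ℚ} (h : y ^ 2 + x * y = x ^ 3 + 8 * m * x ^ 2 + m * (16 * m + 1) * x)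
    (h₂ : x + 4 * m ≠ 0) : PadicSqLike p (x + 4 * m) := by
  obtain ⟨hv4, hvm⟩ := padicValRat_four_eq_zero_of_dvd (p := p) hpl
  have hY := sq_eq_descentTriple h
  have hl0 : (16 * m + 1 : ℤ) ≠ 0 := by omega
  have hl0' : (16 * (m : ℚ) + 1) ≠ 0 := by exact_mod_cast hl0
  have hvl : (1 : ℤ) ≤ padicValRat p ((16 * m + 1 : ℤ) : ℚ) :=
    (padicValRat_intCast_of_dvd hpl).resolve_left (by exact_mod_cast hl0)
  have hcast : ((16 * m + 1 : ℤ) : ℚ) = 16 * (m : ℚ) + 1 := by push_cast; ring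
  rw [hcast] at hvl
  have hm0 : (m : ℚ) ≠ 0 := by
    rintro h0
    have : padicValRat p (16 * (m : ℚ) + 1) = 0 := by rw [h0]; simp
    omega
  have hv4m : padicValRat p (4 * (m : ℚ)) = 0 := by
    rw [padicValRat.mul (by norm_num) hm0, hv4, hvm]; rfl
  by_cases hA : x ≠ 0 ∧ padicValRat p x < padicValRat p (16 * (m : ℚ) + 1)
  · -- Case A: `s = Y / x`
    obtain ⟨hx0, hlt⟩ := hA
    have h₃ : x + (16 * m + 1) / 4 ≠ 0 := by
      intro h3
      have hx : x = -((16 * (m : ℚ) + 1) / 4) := by linear_combination h3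
      rw [hx, padicValRat.neg, padicValRat.div hl0' (by norm_num), hv4] at hlt
      omega
    refine ⟨(y + x / 2) / x, Or.inr ?_⟩
    have key : x + 4 * m - ((y + x / 2) / x) ^ 2 =
        -((x + 4 * m) * ((16 * m + 1) / (4 * x))) := by
      field_simp
      linear_combination (-16 : ℚ) * hY
    rw [key, padicValRat.neg, padicValRat.mul h₂ (div_ne_zero hl0' (by positivity)),
      padicValRat.div hl0' (by positivity), padicValRat.mul (by norm_num) hx0, hv4]
    omega
  · -- Case B: `x = 0` or `v(x) ≥ v(16m+1) ≥ 1`; `s = i / 2` with `i² ≡ -1 (mod p)`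
    have hB : x = 0 ∨ (1 : ℤ) ≤ padicValRat p x := by
      by_cases hx0 : x = 0
      · exact Or.inl hx0
      · right; push Not at hA; have := hA hx0; omega
    obtain ⟨r, hr⟩ := (ZMod.exists_sq_eq_neg_one_iff (p := p)).mpr (by omega)
    set i : ℤ := (r.val : ℤ) with hi
    have hdvd : (p : ℤ) ∣ i ^ 2 + 1 := by
      refine (ZMod.intCast_zmod_eq_zero_iff_dvd _ p).mp ?_
      have hri : ((i : ℤ) : ZMod p) = r := by rw [hi]; push_cast; exact ZMod.natCast_zmod_val r
      push_cast
      rw [hri, sq, ← hr]; ring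
    have hvd : padicValRat p (x + 4 * m) = 0 := by
      rw [add_comm, ← hv4m]
      exact (padicValRat_add_eq_left (p := p) (by positivity) (hB.imp_right fun h1 => by
        rw [hv4m]; omega)).2
    refine ⟨(i : ℚ) / 2, ?_⟩
    have key : x + 4 * m - ((i : ℚ) / 2) ^ 2 = x + (((16 * m + 1 - (i ^ 2 + 1) : ℤ) : ℚ)) / 4 := by
      push_cast; ring
    rw [key, hvd]
    have hN : (((16 * m + 1 - (i ^ 2 + 1) : ℤ) : ℚ)) / 4 = 0 ∨
        (1 : ℤ) ≤ padicValRat p ((((16 * m + 1 - (i ^ 2 + 1) : ℤ) : ℚ)) / 4) := by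
      rcases padicValRat_intCast_of_dvd (p := p) (dvd_sub hpl hdvd) with h0 | h1
      · exact Or.inl (by rw [h0, zero_div])
      · refine Or.inr ?_
        rw [padicValRat.div (by intro h0; rw [h0] at h1; simp at h1) (by norm_num), hv4]
        omega
    rcases le_padicValRat_add_or (p := p) hB hN with h0 | h1
    · exact Or.inl h0
    · exact Or.inr (by omega)

/-- **Kramer's Lemma 2 (iii), containment half** (`q ∣ m`, `q` odd, `b₂ = 1 + 32m ∈ ℚ_q²`):
the third descent coordinate `x + (16m+1)/4 = x - e₃` of every rational point of `A` is a
`q`-adic square (to first order) — `T_q = {(a, a, 1)}`. Elementary proof: if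
`v_q(x) < v_q(m)` then `x + (16m+1)/4 - (Y/x)² = -(x + (16m+1)/4) · 4m/x`; otherwise
`x + (16m+1)/4 - (1/2)² = x + 4m` has positive valuation. This yields the necessity of
Kramer's condition `(b_q)`. [cite: Kramer1983, Lemma 2 (iii) and §5 (b_q)] -/
theorem padicSqLike_x_add_l_div_four {m : ℤ} (hqm : (p : ℤ) ∣ m) (hm0 : m ≠ 0) (hp2 : p ≠ 2)
    {x y : ℚ} (h : y ^ 2 + x * y = x ^ 3 + 8 * m * x ^ 2 + m * (16 * m + 1) * x)
    (h₃ : x + (16 * m + 1) / 4 ≠ 0) : PadicSqLike p (x + (16 * m + 1) / 4) := by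
  have hY := sq_eq_descentTriple h
  have hm0' : (m : ℚ) ≠ 0 := by exact_mod_cast hm0
  have hvm : (1 : ℤ) ≤ padicValRat p (m : ℚ) :=
    (padicValRat_intCast_of_dvd hqm).resolve_left hm0'
  have hp4 : ¬ (p : ℤ) ∣ 4 := by
    have h4 : ¬ p ∣ 4 := fun h4 =>
      hp2 ((Nat.prime_dvd_prime_iff_eq Fact.out Nat.prime_two).mp
        (Nat.Prime.dvd_of_dvd_pow Fact.out (show p ∣ 2 ^ 2 from h4)))
    exact_mod_cast h4
  have hv4 : padicValRat p (4 : ℚ) = 0 := by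
    have h4 := padicValRat_intCast_eq_zero (p := p) hp4
    rwa [show ((4 : ℤ) : ℚ) = 4 by norm_num] at h4
  have hv4m : padicValRat p (4 * (m : ℚ)) = padicValRat p (m : ℚ) := by
    rw [padicValRat.mul (by norm_num) hm0', hv4, zero_add]
  have hvq : padicValRat p ((1 : ℚ) / 4) = 0 := by
    rw [padicValRat.div one_ne_zero (by norm_num), hv4, padicValRat.one]; rfl
  by_cases hA : x ≠ 0 ∧ padicValRat p x < padicValRat p (m : ℚ)
  · -- Case A: `s = Y / x`
    obtain ⟨hx0, hlt⟩ := hA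
    have h₂ : x + 4 * m ≠ 0 := by
      intro h2
      have hx : x = -(4 * (m : ℚ)) := by linear_combination h2
      rw [hx, padicValRat.neg, hv4m] at hlt
      exact lt_irrefl _ hlt
    refine ⟨(y + x / 2) / x, Or.inr ?_⟩
    have key : x + (16 * m + 1) / 4 - ((y + x / 2) / x) ^ 2 =
        -((x + (16 * m + 1) / 4) * ((4 * m) / x)) := by
      field_simp
      linear_combination (-16 : ℚ) * hY
    rw [key, padicValRat.neg, padicValRat.mul h₃ (div_ne_zero (by positivity) hx0),
      padicValRat.div (by positivity) hx0, hv4m]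
    omega
  · -- Case B: `x = 0` or `v(x) ≥ v(m) ≥ 1`; `s = 1/2`
    have hB : x = 0 ∨ (1 : ℤ) ≤ padicValRat p x := by
      by_cases hx0 : x = 0
      · exact Or.inl hx0
      · right; push Not at hA; have := hA hx0; omega
    have hxm : x + 4 * m = 0 ∨ (1 : ℤ) ≤ padicValRat p (x + 4 * m) :=
      le_padicValRat_add_or (p := p) hB (Or.inr (by rw [hv4m]; exact hvm))
    have hvd : padicValRat p (x + (16 * m + 1) / 4) = 0 := by
      rw [show x + (16 * (m : ℚ) + 1) / 4 = 1 / 4 + (x + 4 * m) by ring, ← hvq]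
      exact (padicValRat_add_eq_left (p := p) (by norm_num) (hxm.imp_right fun h1 => by
        rw [hvq]; omega)).2
    refine ⟨1 / 2, ?_⟩
    rw [show x + (16 * (m : ℚ) + 1) / 4 - (1 / 2) ^ 2 = x + 4 * m by ring, hvd]
    exact hxm.imp_right fun h1 => by omega

/-- **Kramer's Lemma 2 (v), containment half** (`m > 0`): on real points the third descent
coordinate is positive and the first two have the same sign — `T_∞ = {(a, a, 1)}` — since
`x < x + 4m < x + (16m+1)/4` have square product. [cite: Kramer1983, Lemma 2 (v)] -/
theorem descentTriple_pos {m x y : ℚ} (hm : 0 < m)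
    (h : y ^ 2 + x * y = x ^ 3 + 8 * m * x ^ 2 + m * (16 * m + 1) * x)
    (h₃ : x + (16 * m + 1) / 4 ≠ 0) :
    0 < x + (16 * m + 1) / 4 ∧ 0 ≤ x * (x + 4 * m) := by
  have hY := sq_eq_descentTriple h
  have hsq : 0 ≤ x * (x + 4 * m) * (x + (16 * m + 1) / 4) := by rw [← hY]; exact sq_nonneg _
  rcases lt_or_gt_of_ne h₃ with hlt | hgt
  · exfalso
    have hd2 : x + 4 * m < 0 := by linarith
    have hx : x < 0 := by linarith
    have h12 : 0 < x * (x + 4 * m) := mul_pos_of_neg_of_neg hx hd2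
    have : x * (x + 4 * m) * (x + (16 * m + 1) / 4) < 0 := mul_neg_of_pos_of_neg h12 hlt
    linarith
  · refine ⟨hgt, ?_⟩
    by_contra hneg
    push Not at hneg
    have : x * (x + 4 * m) * (x + (16 * m + 1) / 4) < 0 := mul_neg_of_neg_of_pos hneg hgt
    linarith

/-- The constant value `-m = (e₂ - e₁)(e₂ - e₃)` of the second descent coordinate at
`T₂ = (-4m, 2m)` is a `p`-adic square (to first order) at every `p ∣ 16m + 1`:
`-m - (1/4)² = -(16m+1)/16`. [cite: Kramer1983, Lemma 2 (iv)] -/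
theorem padicSqLike_neg_m {m : ℤ} (hpl : (p : ℤ) ∣ 16 * m + 1) : PadicSqLike p (-(m : ℚ)) := by
  obtain ⟨hv4, hvm⟩ := padicValRat_four_eq_zero_of_dvd (p := p) hpl
  refine ⟨1 / 4, ?_⟩
  have key : -(m : ℚ) - (1 / 4) ^ 2 = -((((16 * m + 1 : ℤ) : ℚ)) / 16) := by push_cast; ring
  rw [key, padicValRat.neg, padicValRat.neg, hvm]
  rcases padicValRat_intCast_of_dvd (p := p) hpl with h0 | h1
  · exact Or.inl (by rw [h0]; simp)
  · refine Or.inr ?_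
    rw [padicValRat.div (by intro h0; rw [h0] at h1; simp at h1) (by norm_num),
      show (16 : ℚ) = 4 ^ 2 by norm_num, padicValRat.pow, hv4]
    omega

/-- `16m + 1` is a `q`-adic square (to first order) at every `q ∣ m`:
`(16m+1) - 1² = 16m`. [cite: Kramer1983, Lemma 2 (iii)] -/
theorem padicSqLike_l {m : ℤ} (hqm : (p : ℤ) ∣ m) (hm0 : m ≠ 0) :
    PadicSqLike p (16 * (m : ℚ) + 1) := by
  refine ⟨1, ?_⟩
  have hm0' : (m : ℚ) ≠ 0 := by exact_mod_cast hm0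
  have hvm : (1 : ℤ) ≤ padicValRat p (m : ℚ) := (padicValRat_intCast_of_dvd hqm).resolve_left hm0'
  have hl : padicValRat p (16 * (m : ℚ) + 1) = 0 := by
    have hndvd : ¬ (p : ℤ) ∣ 16 * m + 1 := by
      intro hl
      have h1 : (p : ℤ) ∣ 1 := by
        have := dvd_sub hl (dvd_mul_of_dvd_right hqm 16)
        rwa [show 16 * m + 1 - 16 * m = 1 by ring] at this
      exact (Fact.out : p.Prime).ne_one (by exact_mod_cast Int.eq_one_of_dvd_one (by positivity) h1)
    have := padicValRat_intCast_eq_zero (p := p) hndvd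
    push_cast at this
    exact this
  refine Or.inr ?_
  rw [hl, show 16 * (m : ℚ) + 1 - 1 ^ 2 = 16 * m by ring,
    padicValRat.mul (by norm_num) hm0']
  have h16 : (0 : ℤ) ≤ padicValRat p (16 : ℚ) := by
    have := padicValRat_intCast_nonneg (p := p) 16
    push_cast at this
    exact this
  omega

end SqLike

/-! ### First-order `p`-adic squares and the Legendre symbol -/

section Legendre

variable {p : ℕ} [Fact p.Prime]

/-- The valuation of a rational vanishes iff `p` divides neither numerator nor denominator;
we need: `v_p(t) = 0 ⇒ p ∤ den(t)`. [folklore] -/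
theorem not_dvd_den_of_padicValRat_eq_zero {t : ℚ} (ht : padicValRat p t = 0) : ¬ p ∣ t.den := by
  intro hd
  have hcop : t.num.natAbs.Coprime t.den := t.reduced
  have hn : ¬ p ∣ t.num.natAbs := fun hn =>
    (Fact.out : p.Prime).ne_one (Nat.eq_one_of_dvd_coprimes hcop hn hd)
  have hv : padicValRat p t = (padicValNat p t.num.natAbs : ℤ) - (padicValNat p t.den : ℤ) := by
    rw [padicValRat_def]; rfl
  rw [hv, padicValNat.eq_zero_of_not_dvd hn] at ht
  have : 1 ≤ padicValNat p t.den :=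
    (padicValNat_dvd_iff_le t.den_pos.ne').mp (by rwa [pow_one])
  omega

/-- **A first-order `p`-adic square `M r²` with `p ∤ M` has `(M/p) = 1`.** If
`PadicSqLike p (M r²)` (`r ≠ 0`), then `M ≡ t² (mod p)` for the `p`-unit `t = s/r`, so `M`
is a non-zero square modulo `p`. This is how Kramer's conditions `(a_p)`, `(b_q)` become
linear equations in Legendre symbols. [cite: Kramer1983, §5 (proof of the Theorem, p. 384)] -/
theorem legendreSym_eq_one_of_padicSqLike {M : ℤ} {r : ℚ} (hM : ¬ (p : ℤ) ∣ M) (hr : r ≠ 0)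
    (h : PadicSqLike p ((M : ℚ) * r ^ 2)) : legendreSym p M = 1 := by
  have hM0 : M ≠ 0 := fun h0 => hM (h0 ▸ dvd_zero _)
  have hM0' : (M : ℚ) ≠ 0 := by exact_mod_cast hM0
  have hvM : padicValRat p (M : ℚ) = 0 := padicValRat_intCast_eq_zero hM
  obtain ⟨s, hs⟩ := h
  set t : ℚ := s / r with ht
  -- Claim C: `M - t² = 0` or `v(M - t²) ≥ 1`
  have hMt : (M : ℚ) - t ^ 2 = ((M : ℚ) * r ^ 2 - s ^ 2) / r ^ 2 := by
    rw [ht]; field_simp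
  have hC : (M : ℚ) - t ^ 2 = 0 ∨ (1 : ℤ) ≤ padicValRat p ((M : ℚ) - t ^ 2) := by
    by_cases hz : (M : ℚ) * r ^ 2 - s ^ 2 = 0
    · exact Or.inl (by rw [hMt, hz, zero_div])
    · refine Or.inr ?_
      have hlt := hs.resolve_left hz
      rw [padicValRat.mul hM0' (pow_ne_zero 2 hr), hvM, zero_add] at hlt
      rw [hMt, padicValRat.div hz (pow_ne_zero 2 hr)]
      omega
  -- Claim D: `v(t) = 0`
  have hvt : padicValRat p t = 0 := by
    rcases hC with h0 | h1
    · have htM : t ^ 2 = M := by linear_combination -h0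
      have := congrArg (padicValRat p) htM
      rw [padicValRat.pow, hvM] at this
      omega
    · have ht0 : t ≠ 0 := by
        rintro h0
        rw [h0, show (M : ℚ) - 0 ^ 2 = M by ring, hvM] at h1
        omega
      have key := (padicValRat_add_eq_left (p := p) hM0' (b := -((M : ℚ) - t ^ 2))
        (Or.inr (by rw [padicValRat.neg, hvM]; omega))).2
      rw [show (M : ℚ) + -((M : ℚ) - t ^ 2) = t ^ 2 by ring, padicValRat.pow, hvM] at key
      omega
  have hden : ¬ p ∣ t.den := not_dvd_den_of_padicValRat_eq_zero hvt
  -- Claim E: `p ∣ N := M den² - num²`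
  set N : ℤ := M * (t.den : ℤ) ^ 2 - t.num ^ 2 with hN
  have hNq : (N : ℚ) = ((M : ℚ) - t ^ 2) * (t.den : ℚ) ^ 2 := by
    have hd : (t.den : ℚ) ≠ 0 := by exact_mod_cast t.den_pos.ne'
    rw [hN]; push_cast
    nth_rewrite 3 [← Rat.num_div_den t]
    field_simp
  have hvden : padicValRat p (t.den : ℚ) = 0 := by
    rw [← Int.cast_natCast, padicValRat.of_int]
    simp only [padicValInt, Int.natAbs_natCast, padicValNat.eq_zero_of_not_dvd hden, Nat.cast_zero]
  have hE : (p : ℤ) ∣ N := by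
    rcases hC with h0 | h1
    · have : (N : ℚ) = 0 := by rw [hNq, h0, zero_mul]
      rw [show N = 0 by exact_mod_cast this]
      exact dvd_zero _
    · by_cases hN0 : N = 0
      · rw [hN0]; exact dvd_zero _
      · have hv : (1 : ℤ) ≤ padicValRat p (N : ℚ) := by
          rw [hNq, padicValRat.mul (by intro h0; rw [h0] at h1; simp at h1)
            (pow_ne_zero 2 (by exact_mod_cast t.den_pos.ne')), padicValRat.pow, hvden]
          omega
        rw [padicValRat.of_int] at hv
        have := (padicValInt_dvd_iff 1 N).mpr (Or.inr (by exact_mod_cast hv))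
        rwa [pow_one] at this
  -- Claim F: `M` is a non-zero square mod `p`
  have hMp : ((M : ℤ) : ZMod p) ≠ 0 := by
    rwa [Ne, ZMod.intCast_zmod_eq_zero_iff_dvd]
  have hdp : ((t.den : ℕ) : ZMod p) ≠ 0 := by
    rwa [Ne, ZMod.natCast_eq_zero_iff]
  have hF : ((M : ℤ) : ZMod p) * ((t.den : ℕ) : ZMod p) ^ 2 = ((t.num : ℤ) : ZMod p) ^ 2 := by
    have := (ZMod.intCast_zmod_eq_zero_iff_dvd N p).mpr hE
    rw [hN] at this
    push_cast at this
    linear_combination this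
  refine (legendreSym.eq_one_iff p hMp).mpr ⟨((t.num : ℤ) : ZMod p) / ((t.den : ℕ) : ZMod p), ?_⟩
  field_simp
  linear_combination hF

end Legendre


end Literature.NumberTheory.EllipticCurves.KramerTwoDescent
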